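import Summits.CriticalPhenomena.CardyFormulaZ2.Theorems.CardyIKTransportIKMixedBoxCrossingStubMirrorIndep

/-!
# Mirror, part (e): the reflection-positivity inequalities `μ(E)² ≤ μ(E ∩ Θ₀⁻¹E)`, `μ(E)² ≤ μ(E ∩ Φ₀⁻¹E)`, and `stub_mirror`

Helper file of the line `paired-mirror-exploration` for the crux `IKMixedBoxCrossing` (stmt-CriticalPhenomena-5911, lead
prover-line-stmt-CriticalPhenomena-5911-0), toward the registered stub `stub_mirror : Mirror` (reflection positivity of the
column-mixed IK gauge in the cell row `0`, EVERY pattern `S`).  Vocabulary: `Theorems/CardyIKTransportIKMixedBoxCrossingDefs2.lean`.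
-/

noncomputable section

namespace Summit.CriticalPhenomena.CardyFormulaZ2.Cruxes.IKMixedBoxCrossing.PairedMirrorExploration

open scoped Classical
open MeasureTheory ProbabilityTheory Set
open Literature.Probability.Percolation Literature.Probability.LatticeModels
open Summit.CriticalPhenomena.CardyFormulaZ2.Theorems.IKLinearTransport.PinnedDiagramExchange
open Summit.CriticalPhenomena.CardyFormulaZ2.Theorems.IKQuarterTurn
  (measurePreserving_relabel measurePreserving_compl_int measurePreserving_complEquiv_site cnt mem_Ico_min_max
    xor_left_comm' xor_not_xor_not)

namespace MirrorRP

open scoped ENNReal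
open ProbabilityTheory
open MirrorBasics IndepRestrict

/-- **THE MIRROR INEQUALITY** (reflection positivity of the gauge in the cell row `0`, every pattern `S`):
for every measurable event `E` of observables determined by finitely many cells/faces of the open upper
half-plane, `μIK(obs S ⁻¹' E)² ≤ μIK(obs S ⁻¹' E ∩ Θ₀ ⁻¹' (obs S ⁻¹' E))`. -/
theorem mirror_sq_le (S : Set ℤ) {E : Set Obs} (hE : MeasurableSet E) (hU : UpperDet E) :
    μIK.real (obs S ⁻¹' E) ^ 2 ≤ μIK.real (obs S ⁻¹' E ∩ Θ₀ ⁻¹' (obs S ⁻¹' E)) := by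
  set G : Set Ω := obs S ⁻¹' E with hGdef
  have hG : MeasurableSet G := (measurable_obs' S).2.2 hE
  have hΘG : MeasurableSet (Θ₀ ⁻¹' G) := measurePreserving_Θ₀.measurable hG
  -- the sections
  set g : Set ℤ → ℝ≥0∞ := fun A => νrest (Prod.mk A ⁻¹' G) with hgdef
  have hg_meas : Measurable g := measurable_measure_prodMk_left hG
  have hg_le : ∀ A, g A ≤ 1 := fun A => prob_le_one
  have h1 : μIK G = ∫⁻ A, g A ∂(sitePercolation ℤ half) := by
    rw [μIK_eq_prod, Measure.prod_apply hG]
  have h2 : μIK (G ∩ Θ₀ ⁻¹' G) = ∫⁻ A, g A * g A ∂(sitePercolation ℤ half) := by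
    rw [μIK_eq_prod, Measure.prod_apply (hG.inter hΘG)]
    refine lintegral_congr fun A => ?_
    have hsec : (Prod.mk A ⁻¹' (G ∩ Θ₀ ⁻¹' G) : Set Rest) =
        (Prod.mk A ⁻¹' G) ∩ θrest ⁻¹' (Prod.mk A ⁻¹' G) := by
      ext r; simp only [Set.mem_preimage, Set.mem_inter_iff, Θ₀_eq]
    rw [hsec]
    exact νrest_section_inter_mirror S hE hU A
  -- pass to real integrals and use `variance ≥ 0`
  set gr : Set ℤ → ℝ := fun A => (g A).toReal with hgrdef
  have hgr_meas : Measurable gr := hg_meas.ennreal_toReal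
  have hgr_bound : ∀ A, |gr A| ≤ 1 := fun A => by
    rw [abs_of_nonneg ENNReal.toReal_nonneg]
    exact ENNReal.toReal_le_of_le_ofReal zero_le_one (by simpa using hg_le A)
  have hlt : ∀ A, g A < ⊤ := fun A => (hg_le A).trans_lt ENNReal.one_lt_top
  have hint1 : μIK.real G = ∫ A, gr A ∂(sitePercolation ℤ half) := by
    rw [measureReal_def, h1, ← integral_toReal hg_meas.aemeasurable (Filter.Eventually.of_forall hlt)]
  have hint2 : μIK.real (G ∩ Θ₀ ⁻¹' G) = ∫ A, gr A ^ 2 ∂(sitePercolation ℤ half) := by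
    rw [measureReal_def, h2]
    have h3 : (fun A => g A * g A) = fun A => (g * g) A := rfl
    rw [h3, ← integral_toReal (hg_meas.mul hg_meas).aemeasurable
      (Filter.Eventually.of_forall fun A => ENNReal.mul_lt_top (hlt A) (hlt A))]
    refine integral_congr_ae (Filter.Eventually.of_forall fun A => ?_)
    simp only [hgrdef, Pi.mul_apply, ENNReal.toReal_mul, sq]
  have hmem : MemLp gr 2 (sitePercolation ℤ half) :=
    MemLp.of_bound hgr_meas.aestronglyMeasurable 1 (Filter.Eventually.of_forall hgr_bound)
  have hvar := variance_nonneg gr (sitePercolation ℤ half)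
  rw [variance_eq_sub hmem] at hvar
  rw [hint1, hint2]
  have : (∫ A, gr A ∂(sitePercolation ℤ half)) ^ 2 ≤ ∫ A, (gr ^ 2) A ∂(sitePercolation ℤ half) := by linarith
  simpa using this


/-! ### The colour-flipped mirror `Φ₀` (admissible pairs) -/

/-- `Φ₀` is `A ×` its rest map. -/
theorem Φ₀_eq (ω : Ω) : Φ₀ ω = (ω.1, φrest ω.2) := rfl

/-- `φrest` is measurable. -/
theorem measurable_φrest : Measurable φrest :=
  θrest.measurable.comp (measurable_compl.prodMap measurable_id)

/-- `φrest` preserves `νrest`. -/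
theorem measurePreserving_φrest : MeasurePreserving φrest νrest νrest := by
  have h1 : MeasurePreserving (fun r : Rest => (r.1ᶜ, r.2)) νrest νrest := by
    unfold νrest; exact measurePreserving_compl_int.prod (MeasurePreserving.id _)
  exact measurePreserving_θrest_νrest.comp h1

/-- The upper part of the colour-flipped mirrored rest reads only the lower part of the rest. -/
theorem upR_φrest_loR (r : Rest) : upR (φrest (loR r)) = upR (φrest r) := by
  have h := upR_θrest_loR (r.1ᶜ, r.2)
  -- `loR` commutes with the complement of the row signs on the lower coordinates, up to `upR ∘ θrest`
  rw [φrest, φrest, ← h]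
  simp only [upR, loR, θrest_apply]
  refine Prod.ext ?_ rfl
  ext y
  simp only [Set.mem_inter_iff, SiteConfig.mem_relabel_iff, Equiv.neg_symm, Equiv.neg_apply, UB, LB,
    Set.mem_setOf_eq, Set.mem_compl_iff, not_and, not_le]
  constructor
  · rintro ⟨h1, h3⟩; exact ⟨⟨fun h => by have := h1 h; omega, by omega⟩, h3⟩
  · rintro ⟨⟨h1, -⟩, h3⟩; exact ⟨fun h => (h1 h).elim, h3⟩

/-- The lower part of the colour-flipped mirrored section reads only the lower coordinates. -/
theorem φrest_preimage_section_eq (S : Set ℤ) {E : Set Obs} (hU : UpperDet E) (A : Set ℤ) :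
    (φrest ⁻¹' (Prod.mk A ⁻¹' (obs S ⁻¹' E)) : Set Rest) = loR ⁻¹' (φrest ⁻¹' (Prod.mk A ⁻¹' (obs S ⁻¹' E))) := by
  have h := section_eq_preimage_upR S hU A
  ext r
  constructor
  · intro hr
    have h1 : φrest r ∈ (upR ⁻¹' (Prod.mk A ⁻¹' (obs S ⁻¹' E)) : Set Rest) := h ▸ hr
    have h2 : φrest (loR r) ∈ (upR ⁻¹' (Prod.mk A ⁻¹' (obs S ⁻¹' E)) : Set Rest) := by
      rw [Set.mem_preimage, upR_φrest_loR]; exact h1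
    have h3 : φrest (loR r) ∈ (Prod.mk A ⁻¹' (obs S ⁻¹' E) : Set Rest) := h.symm ▸ h2
    exact h3
  · intro hr
    have h1 : φrest (loR r) ∈ (Prod.mk A ⁻¹' (obs S ⁻¹' E) : Set Rest) := hr
    have h2 : φrest (loR r) ∈ (upR ⁻¹' (Prod.mk A ⁻¹' (obs S ⁻¹' E)) : Set Rest) := h ▸ h1
    have h3 : φrest r ∈ (upR ⁻¹' (Prod.mk A ⁻¹' (obs S ⁻¹' E)) : Set Rest) := by
      rw [Set.mem_preimage, ← upR_φrest_loR]; exact h2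
    have h4 : φrest r ∈ (Prod.mk A ⁻¹' (obs S ⁻¹' E) : Set Rest) := h.symm ▸ h3
    exact h4

/-- Given the column signs, an upper-determined event and its colour-flipped mirror image are independent
with equal conditional probabilities: `ν(G_A ∩ φ⁻¹ G_A) = ν(G_A)²`. -/
theorem νrest_section_inter_flipMirror (S : Set ℤ) {E : Set Obs} (hE : MeasurableSet E) (hU : UpperDet E)
    (A : Set ℤ) :
    νrest ((Prod.mk A ⁻¹' (obs S ⁻¹' E)) ∩ φrest ⁻¹' (Prod.mk A ⁻¹' (obs S ⁻¹' E))) =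
      νrest (Prod.mk A ⁻¹' (obs S ⁻¹' E)) * νrest (Prod.mk A ⁻¹' (obs S ⁻¹' E)) := by
  have hG : MeasurableSet (obs S ⁻¹' E) := (measurable_obs' S).2.2 hE
  have hGA : MeasurableSet (Prod.mk A ⁻¹' (obs S ⁻¹' E) : Set Rest) := measurable_prodMk_left hG
  have hφGA : MeasurableSet (φrest ⁻¹' (Prod.mk A ⁻¹' (obs S ⁻¹' E)) : Set Rest) := measurable_φrest hGA
  have key := indepFun_upR_loR.measure_inter_preimage_eq_mul _ _ hGA hφGA
  rw [← section_eq_preimage_upR S hU A, ← φrest_preimage_section_eq S hU A] at key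
  rw [key, measurePreserving_φrest.measure_preimage hGA.nullMeasurableSet]

/-- **THE COLOUR-FLIPPED MIRROR INEQUALITY** (every `S`): `μIK(obs S ⁻¹' E)² ≤ μIK(obs S ⁻¹' E ∩ Φ₀ ⁻¹'(obs S ⁻¹' E))`
— at `S = univ` the second event is the white crossing of the mirror box, so Smirnov's admissible pairs have
probability `≥ v²` exactly, no decorrelation needed. -/
theorem flipMirror_sq_le (S : Set ℤ) {E : Set Obs} (hE : MeasurableSet E) (hU : UpperDet E) :
    μIK.real (obs S ⁻¹' E) ^ 2 ≤ μIK.real (obs S ⁻¹' E ∩ Φ₀ ⁻¹' (obs S ⁻¹' E)) := by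
  set G : Set Ω := obs S ⁻¹' E with hGdef
  have hG : MeasurableSet G := (measurable_obs' S).2.2 hE
  have hΦG : MeasurableSet (Φ₀ ⁻¹' G) := measurePreserving_Φ₀.measurable hG
  set g : Set ℤ → ℝ≥0∞ := fun A => νrest (Prod.mk A ⁻¹' G) with hgdef
  have hg_meas : Measurable g := measurable_measure_prodMk_left hG
  have hg_le : ∀ A, g A ≤ 1 := fun A => prob_le_one
  have h1 : μIK G = ∫⁻ A, g A ∂(sitePercolation ℤ half) := by
    rw [μIK_eq_prod, Measure.prod_apply hG]
  have h2 : μIK (G ∩ Φ₀ ⁻¹' G) = ∫⁻ A, g A * g A ∂(sitePercolation ℤ half) := by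
    rw [μIK_eq_prod, Measure.prod_apply (hG.inter hΦG)]
    refine lintegral_congr fun A => ?_
    have hsec : (Prod.mk A ⁻¹' (G ∩ Φ₀ ⁻¹' G) : Set Rest) =
        (Prod.mk A ⁻¹' G) ∩ φrest ⁻¹' (Prod.mk A ⁻¹' G) := by
      ext r; simp only [Set.mem_preimage, Set.mem_inter_iff, Φ₀_eq]
    rw [hsec]
    exact νrest_section_inter_flipMirror S hE hU A
  set gr : Set ℤ → ℝ := fun A => (g A).toReal with hgrdef
  have hgr_meas : Measurable gr := hg_meas.ennreal_toReal
  have hgr_bound : ∀ A, |gr A| ≤ 1 := fun A => by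
    rw [abs_of_nonneg ENNReal.toReal_nonneg]
    exact ENNReal.toReal_le_of_le_ofReal zero_le_one (by simpa using hg_le A)
  have hlt : ∀ A, g A < ⊤ := fun A => (hg_le A).trans_lt ENNReal.one_lt_top
  have hint1 : μIK.real G = ∫ A, gr A ∂(sitePercolation ℤ half) := by
    rw [measureReal_def, h1, ← integral_toReal hg_meas.aemeasurable (Filter.Eventually.of_forall hlt)]
  have hint2 : μIK.real (G ∩ Φ₀ ⁻¹' G) = ∫ A, gr A ^ 2 ∂(sitePercolation ℤ half) := by
    rw [measureReal_def, h2]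
    have h3 : (fun A => g A * g A) = fun A => (g * g) A := rfl
    rw [h3, ← integral_toReal (hg_meas.mul hg_meas).aemeasurable
      (Filter.Eventually.of_forall fun A => ENNReal.mul_lt_top (hlt A) (hlt A))]
    refine integral_congr_ae (Filter.Eventually.of_forall fun A => ?_)
    simp only [hgrdef, Pi.mul_apply, ENNReal.toReal_mul, sq]
  have hmem : MemLp gr 2 (sitePercolation ℤ half) :=
    MemLp.of_bound hgr_meas.aestronglyMeasurable 1 (Filter.Eventually.of_forall hgr_bound)
  have hvar := variance_nonneg gr (sitePercolation ℤ half)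
  rw [variance_eq_sub hmem] at hvar
  rw [hint1, hint2]
  have : (∫ A, gr A ∂(sitePercolation ℤ half)) ^ 2 ≤ ∫ A, (gr ^ 2) A ∂(sitePercolation ℤ half) := by linarith
  simpa using this

end MirrorRP

/-- **STUB 6a · `stub_mirror`** (= `Mirror`, registered): reflection positivity of the gauge in the cell row `0`, every `S`, and its
isotropic reading — assembled from `MirrorBasics` (parts (a)–(d)) and `MirrorRP` (the two inequalities). -/
theorem stub_mirror : Mirror :=
  ⟨MirrorBasics.measurePreserving_Θ₀, MirrorBasics.measurePreserving_Φ₀, MirrorBasics.obs_univ_Θ₀,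
    MirrorBasics.obs_univ_Φ₀, fun S _ hE hU => ⟨MirrorRP.mirror_sq_le S hE hU, MirrorRP.flipMirror_sq_le S hE hU⟩⟩

end Summit.CriticalPhenomena.CardyFormulaZ2.Cruxes.IKMixedBoxCrossing.PairedMirrorExploration

end
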